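import Literature.IUT.HodgeArakelov.EtaleThetaDataOfSettingCor218i
import Literature.IUT.HodgeArakelov.EtaleThetaDataOfSettingInversion

/-!
# [IUTchII] Prop 1.4 / 3.4 (i) at the genuine data: the automorphism of `φ(Π^tp_X̲̲) ≅ Π^tp_X̲̲/Ker φ` INDUCED by a
# topological automorphism of `Π^tp_X̲̲` (Π-intrinsic companion; [EtTh] Cor 2.18 (i) by name)

abc-iut cell (WAVE-5 seat abc-iut-w5-d169; holder sub-row «P34i-GENUINE-(P1)» of DAG node IUTchII:Prop3.4(i),
`plan/L6/SUBDAG-IUTchII-Prop-31-33-34.md`; L6-lead §F v1.19s).  S. Mochizuki, *Inter-universal Teichmüller theory II*,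
kurims manuscript (Dec. 2020), Prop. 1.4 p. 27: "there are functorial group-theoretic algorithms [cf. [EtTh], Corollary
2.18, (i)] `Π ↦ Π_Ÿ(Π)`; `Π ↦ (l·Δ_Θ)(Π)` for constructing from `Π` the open subgroup `Π_Ÿ(Π) ⊆ Π` … and a certain
subquotient `(l·Δ_Θ)(Π)` of `Π`"; Prop. 3.4 (i) p. 91 (functoriality of `Π ↦ (Π ↷ Ψ_env(M^Θ_*(Π)))` in isomorphisms
of `Π`).  Claim key `Mochizuki2012` (DISPUTED, D-0012).  [EtTh] (refereed): S. Mochizuki, Publ. RIMS **45** (2009),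
Cor. 2.18 (i) p. 60 — the cell's named FACT `RigidData.Cor218_i` (abc-iut-L2-t2, `ThetaRigidity.lean`; FACT-LIST
F-0620, admissible published prerequisite), consumed BY NAME at abc-iut-L2-t8's `R = C.rigidData μ hC hS h15 L`
(idiom of abc-iut-w4-d013's `EtaleThetaDataOfSettingCor218i.lean`).

WHY THIS FILE.  abc-iut-w5-d169's `EtaleLevels.prop34i_multiradiallyDefined_genuine` (p423712) takes as binder (P1)
a companion `β(α)` on the WHOLE ambient `(Π^tp_X)^Θ` for every `α ∈ Aut_top(Π^tp_X̲̲)`; but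
`φ(Π^tp_X̲̲) ⊊ (Π^tp_X)^Θ` (`C.map_toTheta_Huu`: `φ(Π^tp_X̲̲) ∩ Δ_Θ = l·Δ_Θ`), so such `β` is NOT determined by `α`.
Print is Π-intrinsic: `α` acts on the subquotient `(l·Δ_Θ)(Π) = φ⁻¹(l·Δ_Θ)/Ker φ`.  HERE, for the genuine
`φ : Π^tp_X̲̲ → (Π^tp_X)^Θ` of `EtaleThetaDataOfSetting.lean`:
* `phiRange C := φ(Π^tp_X̲̲) = C.Huu.map D.toTheta` (contains `l·Δ_Θ`), `phiR C : Π^tp_X̲̲ ↠ phiRange C`;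
* under abc-iut-w5-d072's interface-topology hypothesis `hq : IsQuotientMap D.toTheta` (`Sec1ThetaCompanionOfAut`;
  = clause R3 `isQuotientMap_toTheta` of abc-iut-L2-t6's `ThetaSettingOriginClauses`): `toTheta` is an OPEN map
  (`isOpenMap_toTheta`), hence `phiR` is an open quotient map (`isQuotientMap_phiR`);
* for `α ∈ Aut_top(Π^tp_X̲̲)` STABILISING `Ker φ` — the `thetaKer`-clause of F-0620 at `C.rigidData`
  (`mem_ker_phi_iff_of_cor218_i`) — THE induced topological automorphism
  **`rangeAut C hq α hker : phiRange C ≃ₜ* phiRange C`**, `rangeAut (φ g) = φ (α g)` (`rangeAut_phiR`), unique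
  with this property (`rangeAut_unique`), hence `rangeAut_refl` / `rangeAut_trans` / `rangeAut_symm` (a HOMOMORPHISM
  in `α`); it stabilises `l·Δ_Θ` as soon as `α` stabilises `φ⁻¹(l·Δ_Θ)` — the `lDeltaTheta`-clause of F-0620
  (`mem_lDeltaTheta_iff_rangeAut`, `mem_comap_lDeltaTheta_iff_of_cor218_i`);
* when an X-level companion `β ∈ Aut_top((Π^tp_X)^Θ)` with `β ∘ φ = φ ∘ α` DOES exist (abc-iut-w5-d072's
  `thetaCompanionOfAut` for inversions), it agrees with `rangeAut` on `φ(Π^tp_X̲̲)` (`coe_rangeAut_eq_of_companion`).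
Definitions are DATA; no `Prop`-valued definition, no new named fact; nothing here takes a side on [IUTchIII]
Cor. 3.12; typed ≠ proved.
-/

noncomputable section

open Topology
open scoped Pointwise

namespace Literature.IUT.HodgeArakelov

namespace EtaleThetaDataOfSetting

open Literature.AnabelianGeometry.EtaleTheta

variable {p : ℕ} [Fact p.Prime] {D : Literature.AnabelianGeometry.EtaleTheta.ThetaSetting p}
  {E : D.EtaleThetaData} {l : ℕ} (C : E.DoubleUnderline l)

/-! ### 1. `φ(Π^tp_X̲̲)` and the corestriction `φ : Π^tp_X̲̲ ↠ φ(Π^tp_X̲̲)` -/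

/-- **`φ(Π^tp_X̲̲) ⊆ (Π^tp_X)^Θ`**, the image of `Π^tp_X̲̲` in the theta quotient (`≅ Π^tp_X̲̲/Ker φ`: the ambient of
the Π-intrinsic subquotient `(l·Δ_Θ)(Π)`). [cite: Mochizuki2012, Prop 1.4 p.27] -/
abbrev phiRange : Subgroup D.GtpTheta := C.Huu.map D.toTheta

/-- `φ(g) ∈ φ(Π^tp_X̲̲)`. [cite: Mochizuki2012, Prop 1.4 p.27] -/
theorem phi_mem_phiRange (g : Pi C) : phi C g ∈ phiRange C := ⟨(g : D.PiTemp), g.2, rfl⟩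

/-- `l·Δ_Θ ⊆ φ(Π^tp_X̲̲)` (`C.map_toTheta_Huu`: `φ(Π^tp_X̲̲) ∩ Δ_Θ = l·Δ_Θ`). [cite: MochizukiEtTh2009, Prop 2.12 (i) p.45] -/
theorem lDeltaTheta_le_phiRange : D.lDeltaTheta l ≤ phiRange C := by
  rw [← C.map_toTheta_Huu]
  exact inf_le_left

/-- **`φ : Π^tp_X̲̲ → φ(Π^tp_X̲̲)`**, the corestriction. [cite: Mochizuki2012, Prop 1.4 p.27] -/
abbrev phiR : (Pi C) →* phiRange C := (phi C).codRestrict (phiRange C) (phi_mem_phiRange C)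

/-- `phiR`, coerced to `(Π^tp_X)^Θ`. [cite: Mochizuki2012, Prop 1.4 p.27] -/
@[simp] theorem coe_phiR (g : Pi C) : ((phiR C g : phiRange C) : D.GtpTheta) = phi C g := rfl

/-- `φ : Π^tp_X̲̲ → φ(Π^tp_X̲̲)` is onto. [cite: Mochizuki2012, Prop 1.4 p.27] -/
theorem phiR_surjective : Function.Surjective (phiR C) := by
  rintro ⟨_, g, hg, rfl⟩
  exact ⟨⟨g, hg⟩, rfl⟩

/-- `φ : Π^tp_X̲̲ → φ(Π^tp_X̲̲)` is continuous. [cite: MochizukiEtTh2009, §1 p.12] -/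
theorem continuous_phiR : Continuous (phiR C) :=
  Continuous.subtype_mk (D.continuous_toTheta.comp continuous_subtype_val) _

/-- `Ker(φ : Π^tp_X̲̲ → φ(Π^tp_X̲̲)) = Ker φ`. [cite: Mochizuki2012, Prop 1.4 p.27] -/
theorem mem_ker_phiR_iff (x : Pi C) : x ∈ (phiR C).ker ↔ x ∈ (phi C).ker := by
  rw [MonoidHom.mem_ker, MonoidHom.mem_ker, ← coe_phiR, OneMemClass.coe_eq_one]

/-! ### 2. Under `hq`: `toTheta` is open, `φ : Π^tp_X̲̲ ↠ φ(Π^tp_X̲̲)` is an open quotient map -/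

/-- A continuous surjective homomorphism of topological groups that is a topological quotient map is OPEN
(`q⁻¹(q(U)) = U · Ker q`); here for `toTheta` under `hq`. [cite: MochizukiEtTh2009, §1 p.12] -/
theorem isOpenMap_toTheta (hq : IsQuotientMap D.toTheta) : IsOpenMap D.toTheta := by
  intro U hU
  rw [← hq.isOpen_preimage]
  have key : D.toTheta ⁻¹' (D.toTheta '' U) = U * (D.toTheta.ker : Set D.PiTemp) := by
    ext x
    constructor
    · rintro ⟨u, hu, hux⟩
      refine Set.mem_mul.2 ⟨u, hu, u⁻¹ * x, ?_, by group⟩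
      change u⁻¹ * x ∈ D.toTheta.ker
      rw [MonoidHom.mem_ker, map_mul, map_inv, hux, inv_mul_cancel]
    · rintro ⟨u, hu, k, hk, rfl⟩
      refine ⟨u, hu, ?_⟩
      change D.toTheta u = D.toTheta (u * k)
      rw [map_mul, (MonoidHom.mem_ker).1 hk, mul_one]
  rw [key]
  exact hU.mul_right

/-- Under `hq`, `φ : Π^tp_X̲̲ → φ(Π^tp_X̲̲)` is an open map (`Π^tp_X̲̲ ⊆ Π^tp_X` is open: `C.isOpen_Huu`).
[cite: MochizukiEtTh2009, Def 2.5 (i) p.39] -/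
theorem isOpenMap_phiR (hq : IsQuotientMap D.toTheta) : IsOpenMap (phiR C) := by
  intro V hV
  have h1 : IsOpen (((↑) : C.Huu → D.PiTemp) '' V) := C.isOpen_Huu.isOpenMap_subtype_val V hV
  have h2 : IsOpen (D.toTheta '' (((↑) : C.Huu → D.PiTemp) '' V)) := isOpenMap_toTheta hq _ h1
  have h3 : (phiR C) '' V =
      ((↑) : phiRange C → D.GtpTheta) ⁻¹' (D.toTheta '' (((↑) : C.Huu → D.PiTemp) '' V)) := by
    ext t
    constructor
    · rintro ⟨v, hv, rfl⟩
      exact ⟨(v : D.PiTemp), ⟨v, hv, rfl⟩, rfl⟩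
    · rintro ⟨x, ⟨v, hv, rfl⟩, hx⟩
      exact ⟨v, hv, Subtype.ext hx⟩
  rw [h3]
  exact h2.preimage continuous_subtype_val

/-- Under `hq`, `φ : Π^tp_X̲̲ ↠ φ(Π^tp_X̲̲)` is a topological quotient map. [cite: MochizukiEtTh2009, §1 p.12] -/
theorem isQuotientMap_phiR (hq : IsQuotientMap D.toTheta) : IsQuotientMap (phiR C) :=
  (isOpenMap_phiR C hq).isQuotientMap (continuous_phiR C) (phiR_surjective C)

/-! ### 3. The automorphism of `φ(Π^tp_X̲̲)` induced by `α ∈ Aut_top(Π^tp_X̲̲)` stabilising `Ker φ` -/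

section Induced

variable (α : (Pi C) ≃ₜ* (Pi C)) (hker : ∀ x, x ∈ (phi C).ker ↔ α x ∈ (phi C).ker)

include hker in
/-- `α⁻¹` stabilises `Ker φ` if `α` does. [cite: MochizukiEtTh2009, Cor 2.18 (i) p.60] -/
theorem ker_stable_symm (x : Pi C) : x ∈ (phi C).ker ↔ α.symm x ∈ (phi C).ker := by
  rw [hker (α.symm x), ContinuousMulEquiv.apply_symm_apply]

include hker in
/-- `Ker φ ≤ Ker(φ ∘ α)`. [cite: MochizukiEtTh2009, Cor 2.18 (i) p.60] -/
theorem ker_phiR_le_ker_comp : (phiR C).ker ≤ ((phiR C).comp α.toMulEquiv.toMonoidHom).ker := by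
  intro x hx
  rw [MonoidHom.mem_ker, MonoidHom.comp_apply]
  change phiR C (α x) = 1
  rw [← MonoidHom.mem_ker, mem_ker_phiR_iff, ← hker, ← mem_ker_phiR_iff]
  exact hx

/-- The induced ENDOMORPHISM of `φ(Π^tp_X̲̲)`: `φ(g) ↦ φ(α g)` (well defined as `α(Ker φ) ⊆ Ker φ`; Mathlib's
`MonoidHom.liftOfSurjective`). [cite: Mochizuki2012, Prop 1.4 p.27] -/
def rangeMap : phiRange C →* phiRange C :=
  (phiR C).liftOfSurjective (phiR_surjective C)
    ⟨(phiR C).comp α.toMulEquiv.toMonoidHom, ker_phiR_le_ker_comp C α hker⟩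

/-- **`rangeMap (φ g) = φ (α g)`.** [cite: Mochizuki2012, Prop 1.4 p.27] -/
@[simp] theorem rangeMap_phiR (g : Pi C) : rangeMap C α hker (phiR C g) = phiR C (α g) :=
  (phiR C).liftOfRightInverse_comp_apply _ _ _ g

/-- `rangeMap α⁻¹ ∘ rangeMap α = id`. [cite: Mochizuki2012, Prop 1.4 p.27] -/
theorem rangeMap_symm_rangeMap (t : phiRange C) :
    rangeMap C α.symm (ker_stable_symm C α hker) (rangeMap C α hker t) = t := by
  obtain ⟨g, rfl⟩ := phiR_surjective C t
  rw [rangeMap_phiR, rangeMap_phiR, ContinuousMulEquiv.symm_apply_apply]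

/-- `rangeMap α ∘ rangeMap α⁻¹ = id`. [cite: Mochizuki2012, Prop 1.4 p.27] -/
theorem rangeMap_rangeMap_symm (t : phiRange C) :
    rangeMap C α hker (rangeMap C α.symm (ker_stable_symm C α hker) t) = t := by
  obtain ⟨g, rfl⟩ := phiR_surjective C t
  rw [rangeMap_phiR, rangeMap_phiR, ContinuousMulEquiv.apply_symm_apply]

/-- `rangeMap ∘ φ = φ ∘ α` as functions. [cite: Mochizuki2012, Prop 1.4 p.27] -/
theorem rangeMap_comp_phiR : (rangeMap C α hker) ∘ (phiR C) = (phiR C) ∘ α :=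
  funext fun g => rangeMap_phiR C α hker g

/-- Under `hq`, `rangeMap` is continuous (`φ : Π^tp_X̲̲ ↠ φ(Π^tp_X̲̲)` is a quotient map and `rangeMap ∘ φ = φ ∘ α`
is continuous). [cite: MochizukiEtTh2009, §1 p.12] -/
theorem continuous_rangeMap (hq : IsQuotientMap D.toTheta) : Continuous (rangeMap C α hker) := by
  rw [(isQuotientMap_phiR C hq).continuous_iff, rangeMap_comp_phiR]
  exact (continuous_phiR C).comp α.continuous

variable (hq : IsQuotientMap D.toTheta)

/-- **THE topological automorphism of `φ(Π^tp_X̲̲) ≅ Π^tp_X̲̲/Ker φ` induced by `α ∈ Aut_top(Π^tp_X̲̲)`** (for `α`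
stabilising `Ker φ`, under `hq`); inverse: the one induced by `α⁻¹`. DEFINED. [cite: Mochizuki2012, Prop 1.4 p.27] -/
def rangeAut : phiRange C ≃ₜ* phiRange C where
  toFun := rangeMap C α hker
  invFun := rangeMap C α.symm (ker_stable_symm C α hker)
  left_inv t := rangeMap_symm_rangeMap C α hker t
  right_inv t := rangeMap_rangeMap_symm C α hker t
  map_mul' := map_mul _
  continuous_toFun := continuous_rangeMap C α hker hq
  continuous_invFun := continuous_rangeMap C α.symm (ker_stable_symm C α hker) hq

/-- `rangeAut` is `rangeMap` as a function. [cite: Mochizuki2012, Prop 1.4 p.27] -/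
@[simp] theorem rangeAut_apply (t : phiRange C) : rangeAut C α hker hq t = rangeMap C α hker t := rfl

/-- **`rangeAut (φ g) = φ (α g)`** — the compatibility with `φ` demanded of a companion. [cite: Mochizuki2012, Prop 1.4 p.27] -/
theorem rangeAut_phiR (g : Pi C) : rangeAut C α hker hq (phiR C g) = phiR C (α g) := rangeMap_phiR C α hker g

/-- The same, coerced to `(Π^tp_X)^Θ`: `rangeAut (φ g) = φ (α g)`. [cite: Mochizuki2012, Prop 1.4 p.27] -/
theorem coe_rangeAut_phiR (g : Pi C) : ((rangeAut C α hker hq (phiR C g) : phiRange C) : D.GtpTheta) = phi C (α g) := by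
  rw [rangeAut_phiR]; rfl

/-- UNIQUENESS: a topological automorphism of `φ(Π^tp_X̲̲)` compatible with `φ` and `α` IS `rangeAut α`.
[cite: Mochizuki2012, Prop 1.4 p.27] -/
theorem rangeAut_unique (β : phiRange C ≃ₜ* phiRange C) (hβ : ∀ g, β (phiR C g) = phiR C (α g)) :
    β = rangeAut C α hker hq := by
  refine ContinuousMulEquiv.ext fun t => ?_
  obtain ⟨g, rfl⟩ := phiR_surjective C t
  rw [hβ, rangeAut_phiR]

/-- If an X-level companion `β ∈ Aut_top((Π^tp_X)^Θ)` with `β ∘ φ = φ ∘ α` exists (abc-iut-w5-d072's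
`thetaCompanionOfAut` shape), it AGREES with `rangeAut α` on `φ(Π^tp_X̲̲)`. [cite: Mochizuki2012, Cor 1.12 (i) p.57] -/
theorem coe_rangeAut_eq_of_companion (β : D.GtpTheta ≃ₜ* D.GtpTheta) (hφ : ∀ g, β (phi C g) = phi C (α g))
    (t : phiRange C) : ((rangeAut C α hker hq t : phiRange C) : D.GtpTheta) = β t := by
  obtain ⟨g, rfl⟩ := phiR_surjective C t
  rw [coe_rangeAut_phiR, coe_phiR, hφ]

/-- `rangeAut α` stabilises `l·Δ_Θ` (read in `φ(Π^tp_X̲̲)`) as soon as `α` stabilises `φ⁻¹(l·Δ_Θ)` (the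
`lDeltaTheta`-clause of [EtTh] Cor. 2.18 (i)). [cite: MochizukiEtTh2009, Cor 2.18 (i) p.60] -/
theorem mem_lDeltaTheta_iff_rangeAut
    (hA : ∀ x, x ∈ (D.lDeltaTheta l).comap (phi C) ↔ α x ∈ (D.lDeltaTheta l).comap (phi C)) (t : phiRange C) :
    t ∈ (D.lDeltaTheta l).subgroupOf (phiRange C) ↔ rangeAut C α hker hq t ∈ (D.lDeltaTheta l).subgroupOf (phiRange C) := by
  obtain ⟨g, rfl⟩ := phiR_surjective C t
  rw [rangeAut_phiR, Subgroup.mem_subgroupOf, Subgroup.mem_subgroupOf, coe_phiR, coe_phiR]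
  exact hA g

end Induced

/-! ### 4. `rangeAut` is a homomorphism in `α` -/

section Laws

variable (hq : IsQuotientMap D.toTheta)

/-- Congruence in `α`. [cite: Mochizuki2012, Prop 1.4 p.27] -/
theorem rangeAut_congr {α α' : (Pi C) ≃ₜ* (Pi C)} (h : α = α')
    (hker : ∀ x, x ∈ (phi C).ker ↔ α x ∈ (phi C).ker) (hker' : ∀ x, x ∈ (phi C).ker ↔ α' x ∈ (phi C).ker) :
    rangeAut C α hker hq = rangeAut C α' hker' hq := by
  subst h; rfl

/-- `rangeAut id = id`. [cite: Mochizuki2012, Prop 1.4 p.27] -/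
theorem rangeAut_refl (hker : ∀ x, x ∈ (phi C).ker ↔ (ContinuousMulEquiv.refl (Pi C)) x ∈ (phi C).ker) :
    rangeAut C (ContinuousMulEquiv.refl (Pi C)) hker hq = ContinuousMulEquiv.refl (phiRange C) :=
  (rangeAut_unique C _ hker hq (ContinuousMulEquiv.refl _) fun _ => rfl).symm

/-- `rangeAut (α₁ α₂) = rangeAut α₁ ∘ rangeAut α₂` (in `trans` order). [cite: Mochizuki2012, Prop 1.4 p.27] -/
theorem rangeAut_trans (α₁ α₂ : (Pi C) ≃ₜ* (Pi C))
    (h₁ : ∀ x, x ∈ (phi C).ker ↔ α₁ x ∈ (phi C).ker) (h₂ : ∀ x, x ∈ (phi C).ker ↔ α₂ x ∈ (phi C).ker)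
    (h₁₂ : ∀ x, x ∈ (phi C).ker ↔ (α₁.trans α₂) x ∈ (phi C).ker) :
    rangeAut C (α₁.trans α₂) h₁₂ hq = (rangeAut C α₁ h₁ hq).trans (rangeAut C α₂ h₂ hq) :=
  (rangeAut_unique C _ h₁₂ hq _ fun g => by
    rw [ContinuousMulEquiv.trans_apply, rangeAut_phiR, rangeAut_phiR]; rfl).symm

/-- `rangeAut α⁻¹ = (rangeAut α)⁻¹`. [cite: Mochizuki2012, Prop 1.4 p.27] -/
theorem rangeAut_symm (α : (Pi C) ≃ₜ* (Pi C)) (hker : ∀ x, x ∈ (phi C).ker ↔ α x ∈ (phi C).ker) :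
    rangeAut C α.symm (ker_stable_symm C α hker) hq = (rangeAut C α hker hq).symm := rfl

/-- Composites stabilise `Ker φ` if the factors do (bookkeeping for `rangeAut_trans`). [cite: MochizukiEtTh2009, Cor 2.18 (i) p.60] -/
theorem ker_stable_trans {α₁ α₂ : (Pi C) ≃ₜ* (Pi C)}
    (h₁ : ∀ x, x ∈ (phi C).ker ↔ α₁ x ∈ (phi C).ker) (h₂ : ∀ x, x ∈ (phi C).ker ↔ α₂ x ∈ (phi C).ker) (x : Pi C) :
    x ∈ (phi C).ker ↔ (α₁.trans α₂) x ∈ (phi C).ker := by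
  rw [ContinuousMulEquiv.trans_apply, ← h₂, ← h₁]

/-- The identity stabilises `Ker φ`. [cite: MochizukiEtTh2009, Cor 2.18 (i) p.60] -/
theorem ker_stable_refl (x : Pi C) : x ∈ (phi C).ker ↔ (ContinuousMulEquiv.refl (Pi C)) x ∈ (phi C).ker := Iff.rfl

end Laws

/-! ### 5. The stabilisation hypotheses FROM [EtTh] Cor 2.18 (i) (FACT-LIST F-0620) at `C.rigidData` -/

section FromCor218i

variable {N : ℕ+} (μ : D.CyclotomeMod l N)

/-- **The `thetaKer`-clause of [EtTh] Cor. 2.18 (i) at the genuine data**: under the named FACT `Cor218_i` for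
`R = C.rigidData μ hC hS h15 L` (whose `thetaKer` IS `Ker φ`), every topological automorphism of `Π^tp_X̲̲` stabilises
`Ker φ`. [cite: MochizukiEtTh2009, Cor 2.18 (i) p.60] -/
theorem mem_ker_phi_iff_of_cor218_i (hC : D.Compat) (hS : D.Sec2Hyps) (h15 : D.Prop15iii E hC)
    (L : C.CuspLabels) (R : RigidData.{0} N l) (hR : R = C.rigidData μ hC hS h15 L) (h218i : R.Cor218_i)
    (α : (Pi C) ≃ₜ* (Pi C)) (x : Pi C) : x ∈ (phi C).ker ↔ α x ∈ (phi C).ker := by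
  subst hR
  exact mem_iff_apply_mem_of_map_eq α.toMulEquiv _ (h218i α).2.2.2.1 x

/-- **The `lDeltaTheta`-clause of [EtTh] Cor. 2.18 (i) at the genuine data**: under the same FACT (whose
`lDeltaTheta` IS `φ⁻¹(l·Δ_Θ)`), every topological automorphism of `Π^tp_X̲̲` stabilises `φ⁻¹(l·Δ_Θ)`.
[cite: MochizukiEtTh2009, Cor 2.18 (i) p.60] -/
theorem mem_comap_lDeltaTheta_iff_of_cor218_i (hC : D.Compat) (hS : D.Sec2Hyps) (h15 : D.Prop15iii E hC)
    (L : C.CuspLabels) (R : RigidData.{0} N l) (hR : R = C.rigidData μ hC hS h15 L) (h218i : R.Cor218_i)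
    (α : (Pi C) ≃ₜ* (Pi C)) (x : Pi C) :
    x ∈ (D.lDeltaTheta l).comap (phi C) ↔ α x ∈ (D.lDeltaTheta l).comap (phi C) := by
  subst hR
  exact mem_iff_apply_mem_of_map_eq α.toMulEquiv _ (h218i α).2.2.2.2.1 x

/-- **The `Π^tp_Ÿ̲̲`-clause** (abc-iut-w4-d013's `piYddCharacteristic_of_cor218_i`, membership form): every
topological automorphism of `Π^tp_X̲̲` stabilises `Π^tp_Ÿ̲̲`. [cite: MochizukiEtTh2009, Cor 2.18 (i) p.60] -/
theorem mem_PiYdd_iff_of_cor218_i (hC : D.Compat) (hS : D.Sec2Hyps) (h15 : D.Prop15iii E hC)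
    (L : C.CuspLabels) (R : RigidData.{0} N l) (hR : R = C.rigidData μ hC hS h15 L) (h218i : R.Cor218_i)
    (α : (Pi C) ≃ₜ* (Pi C)) (x : Pi C) : x ∈ PiYdd C ↔ α x ∈ PiYdd C :=
  mem_PiYdd_iff_of_piYddCharacteristic C (piYddCharacteristic_of_cor218_i C μ hC hS h15 L R hR h218i) α x

/-- **The Π-intrinsic companion from [EtTh] Cor. 2.18 (i)**: under F-0620 at `C.rigidData` and `hq`, EVERY topological
automorphism `α` of `Π^tp_X̲̲` has its induced topological automorphism of `φ(Π^tp_X̲̲)`, compatible with `φ`,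
stabilising `l·Δ_Θ` — no choice involved. [cite: MochizukiEtTh2009, Cor 2.18 (i) p.60] -/
def rangeAutOfCor218i (hq : IsQuotientMap D.toTheta) (hC : D.Compat) (hS : D.Sec2Hyps) (h15 : D.Prop15iii E hC)
    (L : C.CuspLabels) (R : RigidData.{0} N l) (hR : R = C.rigidData μ hC hS h15 L) (h218i : R.Cor218_i)
    (α : (Pi C) ≃ₜ* (Pi C)) : phiRange C ≃ₜ* phiRange C :=
  rangeAut C α (mem_ker_phi_iff_of_cor218_i C μ hC hS h15 L R hR h218i α) hq

/-- `rangeAutOfCor218i α (φ g) = φ (α g)`. [cite: MochizukiEtTh2009, Cor 2.18 (i) p.60] -/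
theorem rangeAutOfCor218i_phiR (hq : IsQuotientMap D.toTheta) (hC : D.Compat) (hS : D.Sec2Hyps)
    (h15 : D.Prop15iii E hC) (L : C.CuspLabels) (R : RigidData.{0} N l) (hR : R = C.rigidData μ hC hS h15 L)
    (h218i : R.Cor218_i) (α : (Pi C) ≃ₜ* (Pi C)) (g : Pi C) :
    rangeAutOfCor218i C μ hq hC hS h15 L R hR h218i α (phiR C g) = phiR C (α g) :=
  rangeAut_phiR C α _ hq g

/-- `rangeAutOfCor218i α` stabilises `l·Δ_Θ`. [cite: MochizukiEtTh2009, Cor 2.18 (i) p.60] -/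
theorem mem_lDeltaTheta_iff_rangeAutOfCor218i (hq : IsQuotientMap D.toTheta) (hC : D.Compat) (hS : D.Sec2Hyps)
    (h15 : D.Prop15iii E hC) (L : C.CuspLabels) (R : RigidData.{0} N l) (hR : R = C.rigidData μ hC hS h15 L)
    (h218i : R.Cor218_i) (α : (Pi C) ≃ₜ* (Pi C)) (t : phiRange C) :
    t ∈ (D.lDeltaTheta l).subgroupOf (phiRange C) ↔
      rangeAutOfCor218i C μ hq hC hS h15 L R hR h218i α t ∈ (D.lDeltaTheta l).subgroupOf (phiRange C) :=
  mem_lDeltaTheta_iff_rangeAut C α _ hq (mem_comap_lDeltaTheta_iff_of_cor218_i C μ hC hS h15 L R hR h218i α) t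

end FromCor218i

end EtaleThetaDataOfSetting

end Literature.IUT.HodgeArakelov

end
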